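import Mathlib.NumberTheory.Chebyshev
import Mathlib.Analysis.Complex.ExponentialBounds
import Literature.NumberTheory.LFunctions.NicolasCChainCheck
import Literature.NumberTheory.LFunctions.NicolasChainSound
import Literature.NumberTheory.LFunctions.NicolasCriterion
import Literature.Analysis.SpecialFunctions.EulerMascheroniBounds
import HarnessLib

/-!
# RH-FREE — `c(p#) ≥ 2.2088 ≥ c(2)` for the primes `3 ≤ p ≤ 360649` by kernel computation: soundness of the checker (Nicolas 2012, Thm. 1.1 (1.7)); nothing here bears on the truth of RH

RH-FREE; nothing here bears on the truth of RH. The semantic soundness of the `c`-chain checker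
`NicolasCChainCheck.lean` over the complete prime table `ChainTable.table` (`ChainTableFacts.tableOK`),
after `NicolasChainSound.lean` (whose Euler-product ratio `NicolasChain.piRatio`, step lemmas and
table handling are reused): if a chunk of the run succeeds, `runDC fuel s = some s'`, the **invariant**
`Inv s` is transported to `s'` (`runDC_sound`); the initial state satisfies it (`initC_inv`); and the
invariant at a state with prime `P` gives **`c(q#) ≥ 2.2088` for every prime `3 ≤ q ≤ P`** (`Inv.ctwo`),
while **`c(2) ≤ 2.2088`** (`nicolasC_two_le_ctwo`: `e^γ ≤ 1.7810726`, `log log 2 ≥ −0.3666`,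
`√(log 2) ≤ 0.832555`). The kernel fact (the run to `P = 360649 > 599²`) is `NicolasCChainRun.lean`;
the assembly is `NicolasCTwoCriterion.lean`.

## The comparison

`cChk p Lhi Tlo Thi P` is `CTWO·2¹⁶⁰·p ≤ (A − B)·⌊√(Tlo·2⁸⁰)⌋` with `A = (P + GHI)·p·2⁸⁰`,
`B = GHI·(Lhi·p + Thi)`, `GHI ≥ 2⁸⁰ e^γ`, `CTWO ≥ 2.2088·2⁸⁰`. With `Lhi ≥ 2⁸⁰ log p`,
`Tlo ≤ 2⁸⁰ θ(p) ≤ Thi`, `P ≤ 2⁸⁰ Π(p)` and `M = log p + θ(p)/p − 1 ≥ log θ(p)` (`log y ≤ y − 1`),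
`M > 0` (`p ≥ 3`): `A − B ≤ 2¹⁶⁰ p (Π(p) − e^γ M) ≤ 2¹⁶⁰ p (Π(p) − e^γ log θ(p))` and
`⌊√(Tlo 2⁸⁰)⌋ ≤ 2⁸⁰ √θ(p)`, so the test gives `2.2088 ≤ (Π(p) − e^γ log θ(p)) √θ(p) = c(p#)`
(`cChk_sound`, `nicolasC_primorial_eq_piRatio`).

## References

* J.-L. Nicolas, *Small values of the Euler function and the Riemann hypothesis*, Acta Arith. 155
  (2012), 311–321, Thm. 1.1 (1.7), §4. [Nicolas2012]
-/

noncomputable section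

namespace Literature.NumberTheory.LFunctions.NicolasCChain

open ChainCheck ChainTable ThetaChain NicolasChain Real Finset
open scoped Chebyshev

/-! ### The constants -/

/-- `e^γ < 1.7810726` (from `γ < 0.57721571` and ten terms of the exponential series; as in
`NicolasChainSound.lean`). [folklore] -/
private theorem exp_eulerMascheroni_lt_d7 : Real.exp Real.eulerMascheroniConstant < 1.7810726 := by
  have hγ := Literature.Analysis.SpecialFunctions.Real.eulerMascheroniConstant_lt_d8
  have h1 : Real.exp Real.eulerMascheroniConstant < Real.exp 0.57721571 := Real.exp_lt_exp.2 hγ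
  have h2 := Real.exp_bound' (x := (0.57721571 : ℝ)) (by norm_num) (by norm_num) (n := 10)
    (by norm_num)
  have h3 : (∑ m ∈ Finset.range 10, (0.57721571 : ℝ) ^ m / m.factorial) +
      (0.57721571 : ℝ) ^ 10 * (10 + 1) / (Nat.factorial 10 * 10) < 1.7810726 := by
    norm_num [Finset.sum_range_succ, Nat.factorial]
  push_cast at h2
  linarith

/-- `GHI ≥ 2⁸⁰ e^γ`. [folklore] -/
private theorem GHI_ge : 2 ^ 80 * Real.exp Real.eulerMascheroniConstant ≤ (GHI : ℝ) := by
  have h := exp_eulerMascheroni_lt_d7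
  have h2 : (2 : ℝ) ^ 80 * 1.7810726 ≤ (GHI : ℝ) := by norm_num [GHI]
  nlinarith

/-- `CTWO ≥ 2⁸⁰ · 2.2088`. [folklore] -/
private theorem CTWO_ge : (2 : ℝ) ^ 80 * 2.2088 ≤ (CTWO : ℝ) := by norm_num [CTWO]

/-! ### `c(p#)` through `Π(p)` and `θ(p)` -/

/-- `c(p#) = (Π(p) − e^γ log θ(p)) √θ(p)` (`log(p#) = θ(p)`, `p#/φ(p#) = Π(p)`).
[cite: Nicolas2012, (3.4) and §1] -/
theorem nicolasC_primorial_eq_piRatio (p : ℕ) :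
    nicolasC (primorial p) =
      (piRatio p - Real.exp Real.eulerMascheroniConstant * Real.log (θ (p : ℝ))) * Real.sqrt (θ (p : ℝ)) := by
  have hθ : θ (p : ℝ) = Real.log (primorial p) := by
    rw [Chebyshev.theta_eq_log_primorial, Nat.floor_natCast]
  rw [nicolasC, primorial_div_totient_eq_piRatio, hθ]

/-! ### Soundness of the comparison `cChk` -/

/-- **Soundness of `cChk`**: if the test passes and `2⁸⁰ log p ≤ Lhi`, `Tlo ≤ 2⁸⁰ θ(p) ≤ Thi`,
`P ≤ 2⁸⁰ Π(p)` (`p ≥ 3`), then `2.2088 ≤ c(p#)`. [cite: Nicolas2012, Thm. 1.1 (1.7)] -/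
theorem cChk_sound {p Lhi Tlo Thi P : ℕ} (h : cChk p Lhi Tlo Thi P = true) (hp : 3 ≤ p)
    (hL : 2 ^ 80 * Real.log p ≤ (Lhi : ℝ)) (hTlo : (Tlo : ℝ) ≤ 2 ^ 80 * θ (p : ℝ))
    (hT : 2 ^ 80 * θ (p : ℝ) ≤ (Thi : ℝ)) (hP : (P : ℝ) ≤ 2 ^ 80 * piRatio p) :
    (2.2088 : ℝ) ≤ nicolasC (primorial p) := by
  -- the integer test
  have hble : CTWO * SC * SC * p ≤ ((P + GHI) * p * SC - GHI * (Lhi * p + Thi)) * Nat.sqrt (Tlo * SC) := by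
    simpa [cChk, Nat.ble_eq, Nat.mul_eq, Nat.add_eq, Nat.sub_eq] using h
  set A : ℕ := (P + GHI) * p * SC with hA
  set B : ℕ := GHI * (Lhi * p + Thi) with hB
  set R : ℕ := Nat.sqrt (Tlo * SC) with hR
  have hpR : (3 : ℝ) ≤ p := by exact_mod_cast hp
  have hp0 : (0 : ℝ) < p := by linarith
  have hθ0 : 0 < θ (p : ℝ) := Chebyshev.theta_pos (by linarith)
  have hG := GHI_ge
  have hC := CTWO_ge
  have hG0 : (0 : ℝ) < GHI := by norm_num [GHI]
  have heγ : 0 < Real.exp Real.eulerMascheroniConstant := Real.exp_pos _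
  -- the test forces `B < A` (else the right side is `0`)
  have hlhs_pos : 0 < CTWO * SC * SC * p := by
    have hC0 : 0 < CTWO := by norm_num [CTWO]
    have hS0 : 0 < SC := by norm_num [SC]
    exact Nat.mul_pos (Nat.mul_pos (Nat.mul_pos hC0 hS0) hS0) (by omega)
  have hBA : B < A := by
    by_contra hBA
    have : A - B = 0 := Nat.sub_eq_zero_of_le (not_lt.1 hBA)
    rw [this, zero_mul] at hble
    omega
  -- pass to `ℝ`
  have hreal : (CTWO : ℝ) * 2 ^ 80 * 2 ^ 80 * p ≤ ((A : ℝ) - B) * R := by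
    have h1 : ((CTWO * SC * SC * p : ℕ) : ℝ) ≤ (((A - B) * R : ℕ) : ℝ) := Nat.cast_le.2 hble
    push_cast [Nat.cast_sub hBA.le] at h1
    rw [SC_real] at h1
    exact h1
  -- `M = log p + θ/p − 1 ≥ log θ`, `M > 0`
  set M : ℝ := Real.log p + θ (p : ℝ) / p - 1 with hM
  have hlogθ : Real.log (θ (p : ℝ)) ≤ M := by
    have h1 : Real.log (θ (p : ℝ)) - Real.log p = Real.log (θ (p : ℝ) / p) :=
      (Real.log_div hθ0.ne' hp0.ne').symm
    have h2 := Real.log_le_sub_one_of_pos (div_pos hθ0 hp0)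
    rw [hM]; linarith
  have hM0 : 0 < M := by
    have hl3 : (1 : ℝ) < Real.log 3 := by
      rw [Real.lt_log_iff_exp_lt (by norm_num)]
      have := Real.exp_one_lt_d9; linarith
    have hlp : Real.log 3 ≤ Real.log p := Real.log_le_log (by norm_num) hpR
    have : 0 < θ (p : ℝ) / p := div_pos hθ0 hp0
    rw [hM]; linarith
  -- `A − B ≤ 2¹⁶⁰ p (Π − e^γ M)`
  have hAB : (A : ℝ) - B ≤ 2 ^ 80 * 2 ^ 80 * p * (piRatio p - Real.exp Real.eulerMascheroniConstant * M) := by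
    have eA : (A : ℝ) = ((P : ℝ) + GHI) * p * 2 ^ 80 := by rw [hA]; push_cast; rw [SC_real]
    have eB : (B : ℝ) = (GHI : ℝ) * ((Lhi : ℝ) * p + Thi) := by rw [hB]; push_cast; ring
    rw [eA, eB]
    -- `GHI (Lhi p + Thi) ≥ GHI (2⁸⁰ log p · p + 2⁸⁰ θ)` and `GHI ≥ 2⁸⁰ e^γ`, `M > 0`
    have h1 : (GHI : ℝ) * ((2 ^ 80 * Real.log p) * p + 2 ^ 80 * θ (p : ℝ)) ≤
        (GHI : ℝ) * ((Lhi : ℝ) * p + Thi) := by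
      apply mul_le_mul_of_nonneg_left _ hG0.le
      have := mul_le_mul_of_nonneg_right hL hp0.le
      linarith
    have h2 : ((P : ℝ) + GHI) * p * 2 ^ 80 - (GHI : ℝ) * ((2 ^ 80 * Real.log p) * p + 2 ^ 80 * θ (p : ℝ)) =
        2 ^ 80 * p * ((P : ℝ) - (GHI : ℝ) * M) := by
      rw [hM]; field_simp; ring
    have h3 : 2 ^ 80 * Real.exp Real.eulerMascheroniConstant * M ≤ (GHI : ℝ) * M :=
      mul_le_mul_of_nonneg_right hG hM0.le
    have h4 : 2 ^ 80 * p * ((P : ℝ) - (GHI : ℝ) * M) ≤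
        2 ^ 80 * p * (2 ^ 80 * piRatio p - 2 ^ 80 * Real.exp Real.eulerMascheroniConstant * M) := by
      apply mul_le_mul_of_nonneg_left _ (by positivity)
      linarith
    calc ((P : ℝ) + GHI) * p * 2 ^ 80 - (GHI : ℝ) * ((Lhi : ℝ) * p + Thi)
        ≤ ((P : ℝ) + GHI) * p * 2 ^ 80 - (GHI : ℝ) * ((2 ^ 80 * Real.log p) * p + 2 ^ 80 * θ (p : ℝ)) := by
          linarith
      _ = 2 ^ 80 * p * ((P : ℝ) - (GHI : ℝ) * M) := h2
      _ ≤ 2 ^ 80 * p * (2 ^ 80 * piRatio p - 2 ^ 80 * Real.exp Real.eulerMascheroniConstant * M) := h4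
      _ = 2 ^ 80 * 2 ^ 80 * p * (piRatio p - Real.exp Real.eulerMascheroniConstant * M) := by ring
  -- `R ≤ 2⁸⁰ √θ`
  have hRle : (R : ℝ) ≤ 2 ^ 80 * Real.sqrt (θ (p : ℝ)) := by
    have h1 : ((R : ℝ)) ^ 2 ≤ (Tlo : ℝ) * 2 ^ 80 := by
      have h' : ((R ^ 2 : ℕ) : ℝ) ≤ ((Tlo * SC : ℕ) : ℝ) := Nat.cast_le.2 (Nat.sqrt_le' (Tlo * SC))
      push_cast at h'
      rw [SC_real] at h'
      exact h'
    have h2 : (Tlo : ℝ) * 2 ^ 80 ≤ (2 ^ 80 * Real.sqrt (θ (p : ℝ))) ^ 2 := by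
      have e : (2 ^ 80 * Real.sqrt (θ (p : ℝ))) ^ 2 = 2 ^ 80 * (2 ^ 80 * θ (p : ℝ)) := by
        rw [mul_pow, Real.sq_sqrt hθ0.le]; ring
      rw [e, mul_comm]
      exact mul_le_mul_of_nonneg_left hTlo (by positivity)
    have hR0 : (0 : ℝ) ≤ R := Nat.cast_nonneg _
    calc (R : ℝ) = Real.sqrt ((R : ℝ) ^ 2) := (Real.sqrt_sq hR0).symm
      _ ≤ Real.sqrt ((2 ^ 80 * Real.sqrt (θ (p : ℝ))) ^ 2) := Real.sqrt_le_sqrt (h1.trans h2)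
      _ = 2 ^ 80 * Real.sqrt (θ (p : ℝ)) := Real.sqrt_sq (by positivity)
  -- `A − B > 0`, hence `Π − e^γ M > 0`
  have hABpos : (0 : ℝ) < (A : ℝ) - B := by
    have : ((B : ℕ) : ℝ) < A := by exact_mod_cast hBA
    linarith
  have hdiff_pos : 0 < piRatio p - Real.exp Real.eulerMascheroniConstant * M := by
    by_contra hneg
    have : (A : ℝ) - B ≤ 0 :=
      hAB.trans (mul_nonpos_iff.2 (Or.inl ⟨by positivity, not_lt.1 hneg⟩))
    linarith
  -- chain the bounds
  set D : ℝ := piRatio p - Real.exp Real.eulerMascheroniConstant * M with hD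
  have hsqrt0 : 0 ≤ Real.sqrt (θ (p : ℝ)) := Real.sqrt_nonneg _
  have hQ : (0 : ℝ) < 2 ^ 80 * 2 ^ 80 * p := by positivity
  have hkey : (CTWO : ℝ) * 2 ^ 80 * 2 ^ 80 * p ≤
      2 ^ 80 * 2 ^ 80 * p * D * (2 ^ 80 * Real.sqrt (θ (p : ℝ))) := by
    calc (CTWO : ℝ) * 2 ^ 80 * 2 ^ 80 * p ≤ ((A : ℝ) - B) * R := hreal
      _ ≤ ((A : ℝ) - B) * (2 ^ 80 * Real.sqrt (θ (p : ℝ))) := mul_le_mul_of_nonneg_left hRle hABpos.le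
      _ ≤ _ := mul_le_mul_of_nonneg_right hAB (by positivity)
  have hc : (2.2088 : ℝ) ≤ D * Real.sqrt (θ (p : ℝ)) := by
    have h1 : 2 ^ 80 * 2.2088 * (2 ^ 80 * 2 ^ 80 * p) ≤ (CTWO : ℝ) * 2 ^ 80 * 2 ^ 80 * p := by
      calc (2 : ℝ) ^ 80 * 2.2088 * (2 ^ 80 * 2 ^ 80 * p) ≤ (CTWO : ℝ) * (2 ^ 80 * 2 ^ 80 * p) :=
            mul_le_mul_of_nonneg_right hC hQ.le
        _ = _ := by ring
    have h5 : (2 ^ 80 * 2 ^ 80 * p) * ((2 : ℝ) ^ 80 * 2.2088) ≤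
        (2 ^ 80 * 2 ^ 80 * p) * (2 ^ 80 * (D * Real.sqrt (θ (p : ℝ)))) := by
      calc (2 ^ 80 * 2 ^ 80 * p) * ((2 : ℝ) ^ 80 * 2.2088) = 2 ^ 80 * 2.2088 * (2 ^ 80 * 2 ^ 80 * p) := by
            ring
        _ ≤ (CTWO : ℝ) * 2 ^ 80 * 2 ^ 80 * p := h1
        _ ≤ 2 ^ 80 * 2 ^ 80 * p * D * (2 ^ 80 * Real.sqrt (θ (p : ℝ))) := hkey
        _ = _ := by ring
    have h6 : (2 : ℝ) ^ 80 * 2.2088 ≤ 2 ^ 80 * (D * Real.sqrt (θ (p : ℝ))) := le_of_mul_le_mul_left h5 hQ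
    exact le_of_mul_le_mul_left h6 (by positivity)
  rw [nicolasC_primorial_eq_piRatio]
  calc (2.2088 : ℝ) ≤ D * Real.sqrt (θ (p : ℝ)) := hc
    _ ≤ (piRatio p - Real.exp Real.eulerMascheroniConstant * Real.log (θ (p : ℝ))) * Real.sqrt (θ (p : ℝ)) := by
        apply mul_le_mul_of_nonneg_right _ hsqrt0
        have := mul_le_mul_of_nonneg_left hlogθ heγ.le
        rw [hD]; linarith

/-! ### The invariant -/

/-- **The invariant** of the `c`-chain at a state. [cite: Nicolas2012, Thm. 1.1 (1.7)] -/
structure Inv (s : NCS) : Prop where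
  /-- the prime reached is a table entry -/
  mem : s.p ∈ table
  /-- and is prime -/
  prime : s.p.Prime
  /-- `Llo ≤ 2⁸⁰ log p` -/
  Llo_le : (s.Llo : ℝ) ≤ 2 ^ 80 * Real.log s.p
  /-- `2⁸⁰ log p ≤ Lhi` -/
  le_Lhi : 2 ^ 80 * Real.log s.p ≤ s.Lhi
  /-- `Tlo ≤ 2⁸⁰ θ(p)` -/
  Tlo_le : (s.Tlo : ℝ) ≤ 2 ^ 80 * θ (s.p : ℝ)
  /-- `2⁸⁰ θ(p) ≤ Thi` -/
  le_Thi : 2 ^ 80 * θ (s.p : ℝ) ≤ s.Thi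
  /-- `P ≤ 2⁸⁰ Π(p)` -/
  P_le : (s.P : ℝ) ≤ 2 ^ 80 * piRatio s.p
  /-- `c(q#) ≥ 2.2088` for every prime `3 ≤ q ≤ p` -/
  ctwo : ∀ q : ℕ, q.Prime → 3 ≤ q → q ≤ s.p → (2.2088 : ℝ) ≤ nicolasC (primorial q)

/-! ### One step -/

/-- A guard `bif c then X else none` that returns `some` passed its test. [folklore] -/
private theorem bif_some {α : Type} {c : Bool} {X : Option α} {a : α}
    (h : (bif c then X else none) = some a) : c = true ∧ X = some a := by
  cases c <;> simp_all

/-- `Π(p') = Π(p) · p'/(p'−1)` across a prime gap (from `NicolasChainSound`'s private lemma, re-derived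
through `p#/φ(p#)`). [folklore] -/
private theorem piRatio_succ_prime' {p p' : ℕ} (hp' : p'.Prime) (hlt : p < p')
    (hq : ∀ q : ℕ, p < q → q < p' → ¬ q.Prime) :
    piRatio p' = piRatio p * ((p' : ℝ) / ((p' : ℝ) - 1)) := by
  -- `primesLE p' = insert p' (primesLE p)`
  have hset : Nat.primesLE p' = insert p' (Nat.primesLE p) := by
    ext q
    simp only [Nat.mem_primesLE, Finset.mem_insert]
    constructor
    · rintro ⟨hqle, hqp⟩
      rcases hqle.lt_or_eq with h | h
      · right
        refine ⟨?_, hqp⟩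
        by_contra hpq
        exact hq q (not_le.1 hpq) h hqp
      · left; exact h
    · rintro (rfl | ⟨hqle, hqp⟩)
      · exact ⟨le_rfl, hp'⟩
      · exact ⟨hqle.trans hlt.le, hqp⟩
  have hnot : p' ∉ Nat.primesLE p := fun h ↦ absurd (Nat.le_of_mem_primesLE h) (not_le.2 hlt)
  rw [piRatio, hset, Finset.prod_insert hnot, piRatio, mul_comm]

/-- **Soundness of one step.** If `Inv s` holds, `p'` is the table successor of `s.p`, and
`stepC s p' = some s'`, then `Inv s'` and `s'.p = p'`. [cite: Nicolas2012, Thm. 1.1 (1.7)] -/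
theorem stepC_inv {s s' : NCS} (hI : Inv s) {p' : ℕ} {rest : List ℕ}
    (hafter : after s.p table = p' :: rest) (h : stepC s p' = some s') : Inv s' ∧ s'.p = p' := by
  have hT := tableOK
  obtain ⟨p, Llo, Lhi, Tlo, Thi, P⟩ := s
  simp only at hafter hI
  obtain ⟨hmem, hprime, hLlo, hLhi, hTlo, hThi, hPle, hctwo⟩ := hI
  simp only at hmem hprime hLlo hLhi hTlo hThi hPle hctwo
  -- the successor `p'`
  obtain ⟨hp'T, hpp', hmin⟩ := head_after hT.sorted hafter
  have hp'le : p' ≤ 4599989 := hT.bounded p' hp'T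
  have hnoprime : ∀ q : ℕ, p < q → q < p' → ¬ q.Prime := fun q h1 h2 hq =>
    absurd (hmin q (hT.complete q hq (by omega)) h1) (not_le.2 h2)
  have hp0 : 0 < p := hprime.pos
  -- unfold the step
  simp only [stepC, Nat.mul_eq, Nat.sub_eq, Nat.add_eq] at h
  obtain ⟨hg1, h⟩ := bif_not_none h
  simp only [Bool.and_eq_true] at hg1
  obtain ⟨⟨-, hodd⟩, hchk⟩ := hg1
  have hodd' : Odd p' := Nat.odd_iff.2 (Nat.eq_of_beq_eq_true hodd)
  have hp'prime : p'.Prime := primeChk_sound hchk hodd' (by omega)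
  rcases hln : logNext p Llo Lhi p' with _ | ⟨Llo', Lhi'⟩
  · rw [hln] at h; simp at h
  · rw [hln] at h
    simp only at h
    obtain ⟨hg3, h⟩ := bif_some h
    simp only [Option.some.injEq] at h
    subst h
    -- the new enclosures
    obtain ⟨hLlo', hLhi'⟩ := logNext_sound hln hp0 hpp'.le hLlo hLhi
    have hθ' : θ (p' : ℝ) = θ (p : ℝ) + Real.log p' := theta_succ_prime hp'prime hpp' hnoprime
    have hPi' : piRatio p' = piRatio p * ((p' : ℝ) / ((p' : ℝ) - 1)) :=
      piRatio_succ_prime' hp'prime hpp' hnoprime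
    have hp'2 : 2 ≤ p' := hp'prime.two_le
    have hp'3 : 3 ≤ p' := by
      have h1 : p' % 2 = 1 := Nat.odd_iff.1 hodd'
      have := hp'prime.two_le
      omega
    have hp'R : (2 : ℝ) ≤ p' := by exact_mod_cast hp'2
    have hTlo' : ((Tlo + Llo' : ℕ) : ℝ) ≤ 2 ^ 80 * θ (p' : ℝ) := by
      rw [hθ']; push_cast; linarith
    have hThi' : 2 ^ 80 * θ (p' : ℝ) ≤ ((Thi + Lhi' : ℕ) : ℝ) := by
      rw [hθ']; push_cast; linarith
    have hP' : (((P * p') / (p' - 1) : ℕ) : ℝ) ≤ 2 ^ 80 * piRatio p' := by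
      have h1 : (((P * p') / (p' - 1) : ℕ) : ℝ) ≤ ((P * p' : ℕ) : ℝ) / ((p' - 1 : ℕ) : ℝ) :=
        Nat.cast_div_le
      have hsub : ((p' - 1 : ℕ) : ℝ) = (p' : ℝ) - 1 := by
        rw [Nat.cast_sub (by omega)]; push_cast; ring
      rw [hsub] at h1
      push_cast at h1
      have hden : (0 : ℝ) < (p' : ℝ) - 1 := by linarith
      have h2 : ((P : ℝ) * p') / ((p' : ℝ) - 1) ≤ (2 ^ 80 * piRatio p * p') / ((p' : ℝ) - 1) :=
        div_le_div_of_nonneg_right (mul_le_mul_of_nonneg_right hPle (by positivity)) hden.le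
      rw [hPi']
      calc (((P * p') / (p' - 1) : ℕ) : ℝ) ≤ ((P : ℝ) * p') / ((p' : ℝ) - 1) := h1
        _ ≤ (2 ^ 80 * piRatio p * p') / ((p' : ℝ) - 1) := h2
        _ = 2 ^ 80 * (piRatio p * ((p' : ℝ) / ((p' : ℝ) - 1))) := by ring
    have hnew := cChk_sound hg3 hp'3 hLhi' hTlo' hThi' hP'
    refine ⟨⟨hp'T, hp'prime, hLlo', hLhi', hTlo', hThi', hP', ?_⟩, rfl⟩
    intro q hq hq3 hqle
    simp only at hqle
    by_cases hqp : q ≤ p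
    · exact hctwo q hq hq3 hqp
    · have hq' : q = p' := by
        by_contra hne
        exact hnoprime q (by omega) (by omega) hq
      rw [hq']
      exact hnew

/-! ### The run -/

/-- **Soundness of a run** along the table cursor. [folklore] -/
private theorem runC_sound : ∀ (fuel : ℕ) {s s' : NCS}, Inv s → runC fuel s (after s.p table) = some s' →
    Inv s'
  | 0, s, s', hI, h => by
      simp only [runC, Option.some.injEq] at h
      exact h ▸ hI
  | fuel + 1, s, s', hI, h => by
      rcases hseg : after s.p table with _ | ⟨p', rest⟩
      · rw [hseg] at h
        simp only [runC, Option.some.injEq] at h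
        exact h ▸ hI
      · rw [hseg] at h
        simp only [runC] at h
        rcases hst : stepC s p' with _ | s₁
        · rw [hst] at h; simp at h
        · rw [hst] at h
          simp only at h
          obtain ⟨hI₁, hp₁⟩ := stepC_inv hI hseg hst
          have hrest : rest = after s₁.p table := by
            rw [hp₁]; exact tail_after tableOK.sorted hseg
          rw [hrest] at h
          exact runC_sound fuel hI₁ h

/-- **Soundness of a chunk**: `runDC` preserves the invariant. [cite: Nicolas2012, Thm. 1.1 (1.7)] -/
theorem runDC_sound {fuel : ℕ} {s s' : NCS} (hI : Inv s) (h : runDC fuel s = some s') : Inv s' :=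
  runC_sound fuel hI h

/-! ### The initial state and the value `c(2)` -/

/-- `Π(2) = 2`. [folklore] -/
private theorem piRatio_two' : piRatio 2 = 2 := by
  unfold piRatio
  have hset : Nat.primesLE 2 = {2} := by decide
  rw [hset, Finset.prod_singleton]
  norm_num

/-- **The initial state satisfies the invariant** (its `c`-clause is empty: no prime `3 ≤ q ≤ 2`).
[cite: Nicolas2012, Thm. 1.1 (1.7)] -/
theorem initC_inv : Inv initC := by
  refine ⟨tableOK.two_mem, Nat.prime_two, ?_, ?_, ?_, ?_, ?_, ?_⟩
  · simpa [initC] using L2LON_le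
  · simpa [initC] using le_L2HIN
  · simp only [initC]; push_cast; rw [theta_two]; exact L2LON_le
  · simp only [initC]; push_cast; rw [theta_two]; exact le_L2HIN
  · simp only [initC, Nat.mul_eq]; push_cast; rw [piRatio_two', SC_real]; norm_num
  · intro q hq hq3 hq2
    simp only [initC] at hq2
    omega

/-- **`c(2) ≤ 2.2088`**: `c(2) = (2 − e^γ log log 2) √(log 2)` with `e^γ ≤ 1.7810726`,
`log log 2 ≥ −0.3666` (`e^{0.3666} ≥ 1.442762 ≥ 1/log 2` by five terms of the exponential series) and
`√(log 2) ≤ 0.832555`. [cite: Nicolas2012, Thm. 1.1 (1.7) (`c(2) = 2.2085892614…`)] -/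
theorem nicolasC_two_le_ctwo : nicolasC 2 ≤ 2.2088 := by
  rw [nicolasC, Nat.totient_prime Nat.prime_two]
  push_cast
  have hl2 := Real.log_two_gt_d9
  have hl2' := Real.log_two_lt_d9
  have hl0 : 0 < Real.log 2 := by linarith
  have hγ := exp_eulerMascheroni_lt_d7
  have hγ0 := Real.exp_pos Real.eulerMascheroniConstant
  -- `log log 2 ≥ −0.3666`
  have hll : -0.3666 ≤ Real.log (Real.log 2) := by
    rw [Real.le_log_iff_exp_le hl0]
    -- `exp(−0.3666) ≤ log 2 ⟸ 1 ≤ exp(0.3666) · log 2`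
    have h5 : (1.4428 : ℝ) ≤ Real.exp 0.3666 := by
      have h := Real.sum_le_exp_of_nonneg (x := (0.3666 : ℝ)) (by norm_num) 6
      have : (1.4428 : ℝ) ≤ ∑ i ∈ Finset.range 6, (0.3666 : ℝ) ^ i / (i.factorial : ℝ) := by
        norm_num [Finset.sum_range_succ, Nat.factorial]
      exact this.trans h
    have hprod : 1 ≤ Real.exp 0.3666 * Real.log 2 := by nlinarith
    have e : Real.exp (-0.3666) = (Real.exp 0.3666)⁻¹ := by rw [← Real.exp_neg]
    rw [e, inv_le_iff_one_le_mul₀ (Real.exp_pos _)]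
    linarith
  have hll0 : Real.log (Real.log 2) < 0 := Real.log_neg hl0 (by linarith)
  -- `√(log 2) ≤ 0.832555`
  have hsq : Real.sqrt (Real.log 2) ≤ 0.832555 := by
    calc Real.sqrt (Real.log 2) ≤ Real.sqrt (0.832555 ^ 2) := Real.sqrt_le_sqrt (by nlinarith)
      _ = 0.832555 := Real.sqrt_sq (by norm_num)
  have hsq0 : 0 ≤ Real.sqrt (Real.log 2) := Real.sqrt_nonneg _
  have h1 : (2 : ℝ) / 1 - Real.exp Real.eulerMascheroniConstant * Real.log (Real.log 2) ≤ 2.65294122 := by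
    nlinarith
  have h0 : 0 ≤ (2 : ℝ) / 1 - Real.exp Real.eulerMascheroniConstant * Real.log (Real.log 2) := by
    nlinarith
  calc ((2 : ℝ) / 1 - Real.exp Real.eulerMascheroniConstant * Real.log (Real.log 2)) * Real.sqrt (Real.log 2)
      ≤ 2.65294122 * 0.832555 := mul_le_mul h1 hsq hsq0 (by norm_num)
    _ ≤ 2.2088 := by norm_num

/-- **From a finished run**: if the invariant holds at a state with prime `P`, then
`c(2) ≤ 2.2088 ≤ c(q#)` for every prime `3 ≤ q ≤ P`, hence `c(2) ≤ c(q#)` for every prime `q ≤ P`.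
[cite: Nicolas2012, Thm. 1.1 (1.7)] -/
theorem nicolasC_two_le_of_inv {s : NCS} (hI : Inv s) {q : ℕ} (hq : q.Prime) (hle : q ≤ s.p) :
    nicolasC 2 ≤ nicolasC (primorial q) := by
  rcases lt_or_ge q 3 with hlt | hge
  · have : q = 2 := by have := hq.two_le; omega
    subst this
    rw [primorial_two]
  · exact nicolasC_two_le_ctwo.trans (hI.ctwo q hq hge hle)

end Literature.NumberTheory.LFunctions.NicolasCChain

end
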